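import Summits.ResolutionOfSingularities.ResolutionOfSingularities.Theorems.FrobeniusClosingPatchingRelPerfectCoreRungMaximalPowers
import Literature.AlgebraicGeometry.Resolution.ArithmeticalThreefoldsLocalPolyhedron
import Literature.AlgebraicGeometry.Resolution.BlowupsScaling
import HarnessLib

/-!
# Crux `PatchingRelPerfect` (stmt-ResolutionOfSingularities-16161), chain w52 — CORE RUNG r1a:
# the blow-up-form open core on REDUCTIONS OF POWERS OF THE MAXIMAL IDEAL
# (Frobenius-sandwich ideals `(x₁ᵃ, …, x_nᵃ) + J`, `J ⊆ 𝔪ᵃ`)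

[OURS · L1 W5.2 · rung] The open core of the registered skeleton v5.1 of the line
`closed-point-slice` is `stub_atomDimFourBlowup` (`AtomDimFourBlowupAt p`): for `S` complete
regular local of dimension `4`, characteristic `p`, perfect residue field, `I ≠ 0` an ideal and
`T = Bl_I Spec S` regular off the closed fibre, a non-zero fibre-cosupported ideal sheaf `J` on `T`
with REGULAR blowing up.  In companion language (W2, `atomConclusion_of_companion_regularLocal`,
Stacks 080A): a non-zero ideal `Q ⊇ 𝔪ᴺ` with `Bl_{I·Q} Spec S` regular suffices.  CHAIN.md v0.3 §2
asks idle seats for RUNGS = the core restricted to named families of ideals, the first family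
being the `𝔪`-primary MONOMIAL ideals; rung r0 (stub-1, `coreRung_pow_maximalIdeal`) did `I = 𝔪ᵈ`.

This file lands rung **r1a: the ideals `I` with `I · 𝔪ᴺ = 𝔪ᵈ` for some `N, d`** (equivalently,
for a regular local `S`: the reductions of a power of `𝔪`), with the EXPLICIT companion `Q = 𝔪ᴺ`:
`Bl_{I·𝔪ᴺ} = Bl_{𝔪ᵈ} ≅ Bl_𝔪 Spec S` is regular (rung r0).  By a pigeonhole on exponent vectors
(`span_pow_le_span_powers_mul_pow`: every monomial of degree `≥ a + N` in generators
`u₁, …, u_n` of `𝔪` is `u_jᵃ ·` (a monomial of degree `≥ N`) as soon as `n (a - 1) < a + N`) the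
family contains every **Frobenius-sandwich ideal** `(u₁ᵃ, …, u_nᵃ) ⊆ I ⊆ 𝔪ᵃ`, for which
`I · 𝔪ᴺ = 𝔪ᵃ⁺ᴺ` (`mul_pow_eq_pow_of_sandwich`).  In dimension `4` this is in particular the whole
closed-point family `(x₁ᵖ, x₂ᵖ, x₃ᵖ, x₄ᵖ, q)`, `q ∈ 𝔪ᵖ` (e.g. `q = x₁x₄ + x₂x₃` at `p = 2`), of the
planner's companion search K5.2b (CHAIN.md §4): companion `Q = 𝔪^{3(p-1)+1}`, FOUND for every `p`
and every regular local base, kernel-checked.  Also the scaled family `I · 𝔪ᴺ = (c) · 𝔪ᵈ`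
(`c ≠ 0`; same blowing ups by `isBlowup_span_singleton_mul_iff`).

Everything holds in EVERY dimension and for EVERY regular local base `S`: none of completeness,
characteristic, residue field or `dim S = 4` is used, and the atom's hypothesis "regular off the
closed fibre" is automatic here (`𝔪ᵈ ⊆ I`).  BC5-type evidence for the core on an `𝔪`-primary
stratum OUTSIDE the toric regime needing fan regularity (general `𝔪`-primary monomial ideals,
CHAIN r1, are NOT covered; nor is the squarefree Veronese ideal, r2).  Nothing here is a
statement of the manuscript under review.

Results: algebra `CoreRung.uPow_single_pow`, `CoreRung.exists_le_of_lt_sum`,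
`CoreRung.uPow_mem_span_powers_mul_pow`, `CoreRung.span_pow_le_span_powers_mul_pow`,
`CoreRung.span_powers_mul_pow_eq_pow`, `CoreRung.mul_pow_eq_pow_of_sandwich`; geometry
`coreRung_of_maximalIdeal_eq_bot`, `atomConclusion_of_mul_eq_of_forall_isRegular`,
`coreRung_of_mul_pow_maximalIdeal_eq_pow`, `coreRung_of_mul_pow_maximalIdeal_eq_span_singleton_mul_pow`,
`coreRung_of_sandwich`, `coreRung_span_powers_sup`.

## References

* The Stacks Project, Tags 080A, 0804. [StacksProject]
* V. Cossart, O. Piltant, *Resolution of singularities of arithmetical threefolds*, J. Algebra 529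
  (2019), Ch. 2 (arXiv v1 p. 9: the monomial filtration `I_𝟙(k) = 𝔪ᵏ`). [CossartPiltant2019]
* O. Villamayor U., *On flattening of coherent sheaves and of projective morphisms*, J. Algebra 295
  (2006), proof of Thm. 3.3 (isomorphic fractional ideals have the same blow-up). [Villamayoru2006]
-/

-- `Summit.<Summit>.<Sub>.Theorems` with `Sub = Summit` (single-conjunct summit, D-0017)
set_option linter.dupNamespace false

noncomputable section

open CategoryTheory CategoryTheory.Limits AlgebraicGeometry Literature.AlgebraicGeometry.Resolution

namespace Summit.ResolutionOfSingularities.ResolutionOfSingularities.Theorems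

universe u

/-! ## Algebra: powers of generators times powers of the ideal (pigeonhole) -/

namespace CoreRung

variable {S : Type u} [CommRing S] {n : ℕ}

/-- `u^{a·e_j} = u_jᵃ`. [folklore] -/
theorem uPow_single_pow (u : Fin n → S) (j : Fin n) (a : ℕ) :
    CossartPiltant.uPow u (Pi.single j a) = u j ^ a := by
  rw [CossartPiltant.uPow, Finset.prod_eq_single j]
  · rw [Pi.single_eq_same]
  · intro i _ hij
    rw [Pi.single_eq_of_ne hij, pow_zero]
  · intro hj
    exact absurd (Finset.mem_univ j) hj

/-- Pigeonhole on exponent vectors: if `Σ_j x_j ≥ M > n (a - 1)` then some `x_j ≥ a`. [folklore] -/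
theorem exists_le_of_lt_sum {x : Fin n → ℕ} {a M : ℕ} (hM : n * (a - 1) < M)
    (hx : M ≤ ∑ j, x j) : ∃ j, a ≤ x j := by
  by_contra h
  simp only [not_exists, not_le] at h
  have hle : ∑ j, x j ≤ n * (a - 1) := by
    calc ∑ j, x j ≤ ∑ _j : Fin n, (a - 1) :=
          Finset.sum_le_sum fun j _ => Nat.le_sub_one_of_lt (h j)
      _ = n * (a - 1) := by simp
  omega

/-- A monomial `u^x` of degree `Σ x_j ≥ a + N > n (a - 1)` lies in `(u₁ᵃ, …, u_nᵃ) · (u)ᴺ`: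
split off `u_jᵃ` for an index with `x_j ≥ a`. [folklore] -/
theorem uPow_mem_span_powers_mul_pow (u : Fin n → S) {x : Fin n → ℕ} {a N : ℕ}
    (h : n * (a - 1) < a + N) (hx : a + N ≤ ∑ j, x j) :
    CossartPiltant.uPow u x ∈
      Ideal.span (Set.range fun j => u j ^ a) * Ideal.span (Set.range u) ^ N := by
  obtain ⟨j, hj⟩ := exists_le_of_lt_sum h hx
  set y : Fin n → ℕ := x - Pi.single j a with hy
  have hxy : x = Pi.single j a + y := by
    ext i
    simp only [hy, Pi.add_apply, Pi.sub_apply]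
    by_cases hij : i = j
    · subst hij
      rw [Pi.single_eq_same]
      omega
    · rw [Pi.single_eq_of_ne hij]
      omega
  have hsum : a + ∑ i, y i = ∑ i, x i := by
    conv_rhs => rw [hxy]
    simp only [Pi.add_apply, Finset.sum_add_distrib, Finset.sum_pi_single', Finset.mem_univ,
      if_true]
  rw [hxy, CossartPiltant.uPow_add, uPow_single_pow]
  have hja : u j ^ a ∈ Ideal.span (Set.range fun j => u j ^ a) :=
    Ideal.subset_span (show u j ^ a ∈ Set.range (fun j => u j ^ a) from ⟨j, rfl⟩)
  refine Ideal.mul_mem_mul hja (CossartPiltant.uPow_mem_span_pow u ?_)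
  omega

/-- **Pigeonhole for ideals**: `(u)ᵃ⁺ᴺ ⊆ (u₁ᵃ, …, u_nᵃ) · (u)ᴺ` whenever `n (a - 1) < a + N`
(`(u)ᵏ` is generated by the monomials of degree `≥ k`, tree `span_pow_le_monomialIdeal_one`).
[cite: CossartPiltant2019, Ch. 2 (arXiv v1 p. 9)] -/
theorem span_pow_le_span_powers_mul_pow (u : Fin n → S) {a N : ℕ} (h : n * (a - 1) < a + N) :
    Ideal.span (Set.range u) ^ (a + N) ≤
      Ideal.span (Set.range fun j => u j ^ a) * Ideal.span (Set.range u) ^ N := by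
  refine (CossartPiltant.span_pow_le_monomialIdeal_one u (a + N)).trans ?_
  rw [CossartPiltant.monomialIdeal]
  apply Ideal.span_le.mpr
  rintro m ⟨x, hx, rfl⟩
  refine uPow_mem_span_powers_mul_pow u h ?_
  rw [CossartPiltant.weight_one] at hx
  exact_mod_cast hx

/-- **`(u₁ᵃ, …, u_nᵃ) · 𝔪ᴺ = 𝔪ᵃ⁺ᴺ`** for `𝔪 = (u₁, …, u_n)` and `n (a - 1) < a + N`.
[folklore] -/
theorem span_powers_mul_pow_eq_pow (u : Fin n → S) {𝔪 : Ideal S}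
    (hu : Ideal.span (Set.range u) = 𝔪) {a N : ℕ} (h : n * (a - 1) < a + N) :
    Ideal.span (Set.range fun j => u j ^ a) * 𝔪 ^ N = 𝔪 ^ (a + N) := by
  subst hu
  apply le_antisymm
  · rw [pow_add]
    refine Ideal.mul_mono_left (Ideal.span_le.mpr ?_)
    rintro _ ⟨j, rfl⟩
    exact Ideal.pow_mem_pow (Ideal.subset_span (show u j ∈ Set.range u from ⟨j, rfl⟩)) a
  · exact span_pow_le_span_powers_mul_pow u h

/-- **Frobenius sandwich**: if `(u₁ᵃ, …, u_nᵃ) ⊆ I ⊆ 𝔪ᵃ` with `𝔪 = (u₁, …, u_n)`, then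
`I · 𝔪ᴺ = 𝔪ᵃ⁺ᴺ` for `n (a - 1) < a + N` — `I` is a reduction of `𝔪ᵃ`. [folklore] -/
theorem mul_pow_eq_pow_of_sandwich (u : Fin n → S) {𝔪 : Ideal S}
    (hu : Ideal.span (Set.range u) = 𝔪) {I : Ideal S} {a N : ℕ} (h : n * (a - 1) < a + N)
    (hle : I ≤ 𝔪 ^ a) (hmem : ∀ j, u j ^ a ∈ I) : I * 𝔪 ^ N = 𝔪 ^ (a + N) := by
  apply le_antisymm
  · rw [pow_add]
    exact Ideal.mul_mono_left hle
  · rw [← span_powers_mul_pow_eq_pow u hu h]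
    refine Ideal.mul_mono_left (Ideal.span_le.mpr ?_)
    rintro _ ⟨j, rfl⟩
    exact hmem j

end CoreRung

/-! ## Geometry: the rung -/

/-- Degenerate base: if the maximal ideal of the regular local ring `S` is zero (`S` is a field),
every non-zero ideal is `S` and its blowing up `T ≅ Spec S` satisfies the atom's conclusion
(rung r0 with `d = 0`). [folklore] -/
theorem coreRung_of_maximalIdeal_eq_bot {S : Type u} [CommRing S] [IsRegularLocalRing S]
    (hm : IsLocalRing.maximalIdeal S = ⊥) {I : Ideal S} (hI : I ≠ ⊥) (T : Scheme.{u})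
    (f : T ⟶ Spec (.of S)) (hf : IsBlowup f (affineBlowup.idealSheaf I)) :
    ∃ (J : T.IdealSheafData) (T' : Scheme.{u}) (π : T' ⟶ T), J ≠ ⊥ ∧
      (∀ t : T, t ∈ J.support → f.base t = IsLocalRing.closedPoint S) ∧
      IsBlowup π J ∧ Scheme.IsRegular T' := by
  have hS : IsField S := IsLocalRing.isField_iff_maximalIdeal_eq.mpr hm
  have hItop : I = ⊤ := by
    letI := hS.toField
    exact (Ideal.eq_bot_or_top I).resolve_left hI
  subst hItop
  have hf' : IsBlowup f (affineBlowup.idealSheaf (IsLocalRing.maximalIdeal S ^ 0)) := by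
    rwa [pow_zero, Ideal.one_eq_top]
  exact coreRung_pow_maximalIdeal 0 (by rw [pow_zero, Ideal.one_eq_top]; exact top_ne_bot) T f hf'

/-- **Companion by an equation of ideals.** Let `S` be regular local, `I ≠ 0`, and suppose
`I · Q = K` for an `𝔪`-primary `Q ≠ 0` (`𝔪ᵐ ⊆ Q`) such that EVERY blowing up of `Spec S` along
`K̃` is regular.  Then every blowing up `T` of `Spec S` along `Ĩ` satisfies the atom's conclusion
(W2 kernel `atomConclusion_of_companion_regularLocal` with the companion `Q`, a blowing up along
`K̃ = Ĩ·Q̃` existing by `exists_isBlowup`). [cite: StacksProject, Tag 080A] -/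
theorem atomConclusion_of_mul_eq_of_forall_isRegular {S : Type u} [CommRing S]
    [IsRegularLocalRing S] {I Q K : Ideal S} (hIQ : I * Q = K) (hI : I ≠ ⊥) (hQ : Q ≠ ⊥) {m : ℕ}
    (hQm : IsLocalRing.maximalIdeal S ^ m ≤ Q)
    (hK : ∀ (B : Scheme.{u}) (b : B ⟶ Spec (.of S)),
      IsBlowup b (affineBlowup.idealSheaf K) → Scheme.IsRegular B)
    (T : Scheme.{u}) (f : T ⟶ Spec (.of S)) (hf : IsBlowup f (affineBlowup.idealSheaf I)) :
    ∃ (J : T.IdealSheafData) (T' : Scheme.{u}) (π : T' ⟶ T), J ≠ ⊥ ∧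
      (∀ t : T, t ∈ J.support → f.base t = IsLocalRing.closedPoint S) ∧
      IsBlowup π J ∧ Scheme.IsRegular T' := by
  subst hIQ
  obtain ⟨B, b, hb⟩ := exists_isBlowup (Spec (.of S)) (affineBlowup.idealSheaf (I * Q))
  have hBreg : Scheme.IsRegular B := hK B b hb
  rw [affineBlowup.idealSheaf_mul] at hb
  exact atomConclusion_of_companion_regularLocal hf (affineBlowup.idealSheaf_ne_bot hI)
    (affineBlowup.idealSheaf_ne_bot hQ) (support_idealSheaf_subset_closedPoint hQm) hb hBreg

/-- **CORE RUNG r1a (reductions of powers of the maximal ideal).** The blow-up-form open core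
`AtomDimFourBlowupAt` restricted to the family `{I ≠ 0 : I · 𝔪ᴺ = 𝔪ᵈ}` holds — in every
dimension and for every regular local base, with the explicit companion `Q = 𝔪ᴺ`:
`Bl_{I·𝔪ᴺ} = Bl_{𝔪ᵈ} Spec S` is regular (rung r0, `isRegular_of_isBlowup_pow_maximalIdeal`).
BC5-type evidence for the core on this `𝔪`-primary stratum. [cite: StacksProject, Tag 080A] -/
theorem coreRung_of_mul_pow_maximalIdeal_eq_pow {S : Type u} [CommRing S] [IsRegularLocalRing S]
    {I : Ideal S} {N d : ℕ}
    (hIN : I * IsLocalRing.maximalIdeal S ^ N = IsLocalRing.maximalIdeal S ^ d) (hI : I ≠ ⊥)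
    (T : Scheme.{u}) (f : T ⟶ Spec (.of S)) (hf : IsBlowup f (affineBlowup.idealSheaf I)) :
    ∃ (J : T.IdealSheafData) (T' : Scheme.{u}) (π : T' ⟶ T), J ≠ ⊥ ∧
      (∀ t : T, t ∈ J.support → f.base t = IsLocalRing.closedPoint S) ∧
      IsBlowup π J ∧ Scheme.IsRegular T' := by
  by_cases hm : IsLocalRing.maximalIdeal S = ⊥
  · exact coreRung_of_maximalIdeal_eq_bot hm hI T f hf
  · haveI : IsDomain S := isDomain_of_isRegularLocalRing S
    have hQ : IsLocalRing.maximalIdeal S ^ N ≠ ⊥ := by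
      rw [Ne, ← Submodule.zero_eq_bot]
      exact pow_ne_zero N (fun h => hm (h.trans Submodule.zero_eq_bot))
    exact atomConclusion_of_mul_eq_of_forall_isRegular hIN hI hQ le_rfl
      (fun B b hb => isRegular_of_isBlowup_pow_maximalIdeal d hb) T f hf

/-- **CORE RUNG r1a, scaled**: the same for the family `{I ≠ 0 : I · 𝔪ᴺ = (c) · 𝔪ᵈ, c ≠ 0}`
(a blowing up along `((c) 𝔪ᵈ)~` is one along `(𝔪ᵈ)~`, Villamayor / tree
`isBlowup_span_singleton_mul_iff`). [cite: Villamayoru2006, proof of Thm. 3.3]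
[cite: StacksProject, Tag 080A] -/
theorem coreRung_of_mul_pow_maximalIdeal_eq_span_singleton_mul_pow {S : Type u} [CommRing S]
    [IsRegularLocalRing S] {I : Ideal S} {N d : ℕ} {c : S} (hc : c ≠ 0)
    (hIN : I * IsLocalRing.maximalIdeal S ^ N = Ideal.span {c} * IsLocalRing.maximalIdeal S ^ d)
    (hI : I ≠ ⊥) (T : Scheme.{u}) (f : T ⟶ Spec (.of S))
    (hf : IsBlowup f (affineBlowup.idealSheaf I)) :
    ∃ (J : T.IdealSheafData) (T' : Scheme.{u}) (π : T' ⟶ T), J ≠ ⊥ ∧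
      (∀ t : T, t ∈ J.support → f.base t = IsLocalRing.closedPoint S) ∧
      IsBlowup π J ∧ Scheme.IsRegular T' := by
  by_cases hm : IsLocalRing.maximalIdeal S = ⊥
  · exact coreRung_of_maximalIdeal_eq_bot hm hI T f hf
  · haveI : IsDomain S := isDomain_of_isRegularLocalRing S
    have hpow : ∀ k : ℕ, IsLocalRing.maximalIdeal S ^ k ≠ ⊥ := fun k => by
      rw [Ne, ← Submodule.zero_eq_bot]
      exact pow_ne_zero k (fun h => hm (h.trans Submodule.zero_eq_bot))
    refine atomConclusion_of_mul_eq_of_forall_isRegular hIN hI (hpow N) le_rfl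
      (fun B b hb => ?_) T f hf
    exact isRegular_of_isBlowup_pow_maximalIdeal d
      ((isBlowup_span_singleton_mul_iff (hpow d) hc).mp hb)

/-- **CORE RUNG r1a on FROBENIUS-SANDWICH ideals.** For `S` regular local with
`𝔪 = (u₁, …, u_n)` and an ideal `(u₁ᵃ, …, u_nᵃ) ⊆ I ⊆ 𝔪ᵃ`, `I ≠ 0`, every blowing up
`T = Bl_I Spec S` satisfies the atom's conclusion, with companion `Q = 𝔪^{n(a-1)+1}`
(`I · Q = 𝔪^{a+n(a-1)+1}` by the pigeonhole `mul_pow_eq_pow_of_sandwich`).  With `n = 4`,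
`a = p` this is the closed-point family `(x₁ᵖ, …, x₄ᵖ, q)`, `q ∈ 𝔪ᵖ`, of the companion search
K5.2b (CHAIN.md §4), FOUND for every `p`. [cite: StacksProject, Tag 080A]
[cite: CossartPiltant2019, Ch. 2 (arXiv v1 p. 9)] -/
theorem coreRung_of_sandwich {S : Type u} [CommRing S] [IsRegularLocalRing S] {n : ℕ}
    (u : Fin n → S) (hu : Ideal.span (Set.range u) = IsLocalRing.maximalIdeal S) {I : Ideal S}
    {a : ℕ} (hle : I ≤ IsLocalRing.maximalIdeal S ^ a) (hmem : ∀ j, u j ^ a ∈ I) (hI : I ≠ ⊥)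
    (T : Scheme.{u}) (f : T ⟶ Spec (.of S)) (hf : IsBlowup f (affineBlowup.idealSheaf I)) :
    ∃ (J : T.IdealSheafData) (T' : Scheme.{u}) (π : T' ⟶ T), J ≠ ⊥ ∧
      (∀ t : T, t ∈ J.support → f.base t = IsLocalRing.closedPoint S) ∧
      IsBlowup π J ∧ Scheme.IsRegular T' :=
  coreRung_of_mul_pow_maximalIdeal_eq_pow (N := n * (a - 1) + 1) (d := a + (n * (a - 1) + 1))
    (CoreRung.mul_pow_eq_pow_of_sandwich u hu (by omega) hle hmem) hI T f hf

/-- **CORE RUNG r1a, family form `I = (u₁ᵃ, …, u_nᵃ) + J`, `J ⊆ 𝔪ᵃ`** (the shape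
`(x₁ᵖ, x₂ᵖ, x₃ᵖ, x₄ᵖ, q)` of CHAIN.md §4). [cite: StacksProject, Tag 080A] -/
theorem coreRung_span_powers_sup {S : Type u} [CommRing S] [IsRegularLocalRing S] {n : ℕ}
    (u : Fin n → S) (hu : Ideal.span (Set.range u) = IsLocalRing.maximalIdeal S) (a : ℕ)
    {J : Ideal S} (hJ : J ≤ IsLocalRing.maximalIdeal S ^ a)
    (hI : Ideal.span (Set.range fun j => u j ^ a) ⊔ J ≠ ⊥) (T : Scheme.{u})
    (f : T ⟶ Spec (.of S))
    (hf : IsBlowup f (affineBlowup.idealSheaf (Ideal.span (Set.range fun j => u j ^ a) ⊔ J))) :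
    ∃ (J' : T.IdealSheafData) (T' : Scheme.{u}) (π : T' ⟶ T), J' ≠ ⊥ ∧
      (∀ t : T, t ∈ J'.support → f.base t = IsLocalRing.closedPoint S) ∧
      IsBlowup π J' ∧ Scheme.IsRegular T' := by
  have hmem : ∀ j, u j ^ a ∈ Ideal.span (Set.range fun j => u j ^ a) := fun j =>
    Ideal.subset_span (show u j ^ a ∈ Set.range (fun j => u j ^ a) from ⟨j, rfl⟩)
  have hgen : ∀ j, u j ∈ IsLocalRing.maximalIdeal S := fun j =>
    hu ▸ Ideal.subset_span (show u j ∈ Set.range u from ⟨j, rfl⟩)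
  refine coreRung_of_sandwich u hu (a := a) (sup_le (Ideal.span_le.mpr ?_) hJ)
    (fun j => Ideal.mem_sup_left (hmem j)) hI T f hf
  rintro _ ⟨j, rfl⟩
  exact Ideal.pow_mem_pow (hgen j) a

end Summit.ResolutionOfSingularities.ResolutionOfSingularities.Theorems

end
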